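/-
COR-CM cell pub-hodgecm2 — CALIBRATION of Transposition item (iii), MEETING FORM (count-neutral; no BINDER-OWNERS row).
Seat prover-pub-hodgecm2-b07-g39-0 (b07 gen 39), 2026-08-21.  Imports tr-typer-3's `Transposition/Item3Automorphic.lean`
BY NAME; nothing restated.  FRAMING (COORDINATOR RULING 2026-08-21T11:55:35Z): HC_CM is NOT proved; this file shows the
meeting-form typed axiom of item (iii) is inhabited by a TAUTOLOGICAL Hodge–Riemann model — NOT progress on B01.
T5 (lead STAGING 2026-08-21T15:35:57Z (3)) — consistency check by prover-pub-hodgecm2-b07-g50-0 (filer, after p272736 ✔) 2026-08-21T16:10Z: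
no contradiction derivable — KERNEL INHABITATION IN-FILE: every hypothesis binder ({hid, hpos} §§1–3; {hHD, hI, hU, h₃} §4) is discharged
below on the universe of record by the 0-binder theorems `Model.automorphicMeetingExists_rec` / `Model.faceAutomorphicMeetingExists_rec`;
no named-fact / `@[conjecture]` binder is consumed; checker of record pub-hodgecm2-t5-consist-1 (countersign welcome).
-/
import Summits.HodgeConjecture.CorCM.B01.Transposition.Item3Automorphic
import Summits.HodgeConjecture.CorCM.Model.PerLConeFacts
import Literature.AlgebraicGeometry.HodgeTheory.BettiUniverseHodgeRiemannPositive
import Mathlib.Analysis.InnerProductSpace.l2Space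
import HarnessLib

/-!
# The level-orthogonal Hodge–Riemann model of the automorphic MEETING datum (item (iii) calibrated)

`Transposition.AutomorphicMeeting U ι₁ V` (tr-typer-3, `B01/Transposition/Item3Automorphic.lean`) asks for an inner-product
space `HG`, linear maps `emb Γ : H²(P_Γ, ℂ) → HG`, «Petersson = cup pairing on `F²H²(P_Γ)` up to a non-zero constant per
level» (`inner_emb`) and LEVEL-MEETING (`levelMeet`).  These four fields, IN ISOLATION, carry no arithmetic content: they
are inhabited on EVERY universe with `Fact_pull_id` whose Picard modular surfaces satisfy Hodge–Riemann `(2,0)` WITH SIGN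
(`∫ η ∧ η̄ = κ_Γ · t`, `t > 0`; Voisin I Thm. 6.32 — a THEOREM on the universe of record,
`Model.universeOf_hodgeRiemann_pms_positive`), by the **level-orthogonal Hodge–Riemann model** `AutomorphicMeeting.ofHodgeRiemann`:
`HG := ℓ²`-sum over all levels `Γ` of `(F²H²(P_Γ, ℂ), ⟪y, x⟫ := κ_Γ⁻¹ · tr(x ∪ conj y))`; `emb Γ := lp.single Γ ∘`
(a linear projection onto `F²`); `inner_emb Γ` with constant `κ_Γ⁻¹` by construction; `levelMeet` because distinct levels are
ORTHOGONAL (`ofHodgeRiemann_inner_emb_eq_zero_of_ne`), so a non-zero pairing forces `Γ₁ = Γ₂` and the identity morphisms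
witness the meeting.  Consequences, 0 open binders: `automorphicMeetingExists_of_hodgeRiemann`,
`Model.universeOf_automorphicMeetingExists`, `Model.automorphicMeetingExists_rec : AutomorphicMeetingExists U_rec`,
`Model.faceAutomorphicMeetingExists_rec`.

CALIBRATION, NOT PROGRESS.  In this model the MEETING-coupling input `couplingMeet` of the engine `periodNV_of_meeting` at
`(Γ, ω₁, ω₂)` can only be witnessed at the SAME level and there reads `κ_Γ⁻¹ · tr((ω₁ ∪ ω₂) ∪ conj(ω₃ ∪ ω₄)) ≠ 0` — it IS
the period non-vanishing the engine is supposed to produce (`ofHodgeRiemann_inner_emb_wedges_ne_zero_iff`).  So the content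
of PerL §3.1 (Matsushima / adelic Petersson model, PerL v5 tex ll.238–257) is not in the typed axiom but in the NAMED adelic
model — stage 1's `Model.embOf` (`HodgeCM/Model/EmbInstance.lean`:307), where distinct levels are NOT orthogonal (Hecke
translates meet) and about which item (v)'s isolation / coupling (PerL Prop. 3.6 / Thm. 3.7) has content; a prover of item
(iii) ports THAT model, it does not inhabit the `∃`.  The SOCKET-VERBATIM form `AutomorphicDictionary` (tower identity
`emb_cover`) is NOT reached by this model (orthogonal levels violate `emb_cover`).

Theorems and constructions only: no `def … : Prop`, no named fact, no `sorry`; axioms ⊆ {propext, Classical.choice, Quot.sound}.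
Wording of record untouched: HC_CM follows in the kernel from BallQuotientUniformised ∧ PerLFace(model universe of record).
-/

noncomputable section

open scoped TensorProduct InnerProductSpace

namespace Summit.HodgeConjecture.CorCM

namespace Transposition

open Literature.AlgebraicGeometry.Motives (CMType HodgeStructure)
open Literature.AlgebraicGeometry.Motives.HodgeStructure (conj)

/-! ## 0. A sesquilinear form with real diagonal is hermitian (polarisation) -/

/-- Polarisation: a form `S` on a complex vector space, conjugate-linear in the first and linear in the second variable,
whose diagonal values are real (`conj (S v v) = S v v`), is hermitian: `conj (S y x) = S x y`. [folklore] -/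
theorem conj_symm_of_diag_real {F : Type*} [AddCommGroup F] [Module ℂ F] (S : F → F → ℂ)
    (hadd_left : ∀ x y z, S (x + y) z = S x z + S y z) (hadd_right : ∀ x y z, S x (y + z) = S x y + S x z)
    (hsmul_left : ∀ (r : ℂ) (x y : F), S (r • x) y = starRingEnd ℂ r * S x y)
    (hsmul_right : ∀ (r : ℂ) (x y : F), S x (r • y) = r * S x y)
    (hreal : ∀ v, starRingEnd ℂ (S v v) = S v v) (x y : F) : starRingEnd ℂ (S y x) = S x y := by
  have h1 := hreal (x + y)
  rw [hadd_left, hadd_right, hadd_right] at h1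
  simp only [map_add] at h1
  rw [hreal x, hreal y] at h1
  have h2 := hreal (x + Complex.I • y)
  rw [hadd_left, hadd_right, hadd_right, hsmul_right, hsmul_left, hsmul_left, hsmul_right] at h2
  simp only [map_add, map_mul, map_neg, Complex.conj_I, neg_neg] at h2
  rw [hreal x, hreal y] at h2
  have e1 : starRingEnd ℂ (S x y) + starRingEnd ℂ (S y x) = S x y + S y x := by linear_combination h1
  have e2 : Complex.I * (starRingEnd ℂ (S y x) - starRingEnd ℂ (S x y)) = Complex.I * (S x y - S y x) := by
    linear_combination h2
  have e3 : starRingEnd ℂ (S y x) - starRingEnd ℂ (S x y) = S x y - S y x :=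
    mul_left_cancel₀ Complex.I_ne_zero e2
  linear_combination (e1 + e3) / 2

variable {U : Universe} {L : CMField} {ι₁ : L →+* ℂ} {V : HermSpace3 L ι₁}

/-! ## 1. The summands: `F²H²(P_Γ, ℂ)` with the Hodge–Riemann inner product -/

namespace HodgeRiemannModel

/-- The `(2,0)`-step `F²H²(P_Γ, ℂ)` of the Hodge filtration of the Picard modular surface at level `Γ`. [folklore] -/
abbrev F2 (U : Universe) (L : CMField) (ι₁ : L →+* ℂ) (V : HermSpace3 L ι₁) (Γ : Level V) :
    Submodule ℂ (U.CohC (U.pms L ι₁ V Γ) 2) :=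
  (U.hodge (U.pms L ι₁ V Γ) 2).F 2

/-- **Carrier of the level-`Γ` summand**: a type synonym of `F²H²(P_Γ, ℂ)`, to be equipped with the Hodge–Riemann inner
product read off the hypothesis `hpos` (Hodge–Riemann `(2,0)` with sign at every level). [folklore] -/
@[nolint unusedArguments]
def Carrier (_hpos : ∀ Γ : Level V, ∃ κ : ℂ, κ ≠ 0 ∧ ∀ η ∈ F2 U L ι₁ V Γ, η ≠ 0 →
      ∃ t : ℝ, 0 < t ∧ U.trC (U.pms L ι₁ V Γ) 4 (U.cup2C (U.pms L ι₁ V Γ) 2 η (conj η)) = κ * t)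
    (Γ : Level V) : Type :=
  ↥(F2 U L ι₁ V Γ)

variable (hpos : ∀ Γ : Level V, ∃ κ : ℂ, κ ≠ 0 ∧ ∀ η ∈ F2 U L ι₁ V Γ, η ≠ 0 →
  ∃ t : ℝ, 0 < t ∧ U.trC (U.pms L ι₁ V Γ) 4 (U.cup2C (U.pms L ι₁ V Γ) 2 η (conj η)) = κ * t)

/-- Additive group of the summand (that of `F²H²`). [folklore] -/
instance instAddCommGroup (Γ : Level V) : AddCommGroup (Carrier hpos Γ) :=
  inferInstanceAs (AddCommGroup ↥(F2 U L ι₁ V Γ))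

/-- `ℂ`-module structure of the summand (that of `F²H²`). [folklore] -/
instance instModule (Γ : Level V) : Module ℂ (Carrier hpos Γ) :=
  inferInstanceAs (Module ℂ ↥(F2 U L ι₁ V Γ))

/-- The identification `F²H²(P_Γ, ℂ) ≃ Carrier` (the identity). [folklore] -/
def toCarrier (Γ : Level V) : ↥(F2 U L ι₁ V Γ) ≃ₗ[ℂ] Carrier hpos Γ := LinearEquiv.refl ℂ _

/-- The underlying cohomology class of an element of the carrier. [folklore] -/
def val {Γ : Level V} (x : Carrier hpos Γ) : U.CohC (U.pms L ι₁ V Γ) 2 := ((toCarrier hpos Γ).symm x : ↥(F2 U L ι₁ V Γ))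

omit hpos in
/-- The Hodge–Riemann constant `κ_Γ ≠ 0` of level `Γ` (chosen). [folklore] -/
def kappa (Γ : Level V) : ℂ := (hpos Γ).choose

/-- `κ_Γ ≠ 0`. [folklore] -/
theorem kappa_ne_zero (Γ : Level V) : kappa hpos Γ ≠ 0 := (hpos Γ).choose_spec.1

/-- Hodge–Riemann with sign at level `Γ`, with the chosen constant. [folklore] -/
theorem kappa_spec (Γ : Level V) {η : U.CohC (U.pms L ι₁ V Γ) 2} (hη : η ∈ F2 U L ι₁ V Γ) (h0 : η ≠ 0) :
    ∃ t : ℝ, 0 < t ∧ U.trC (U.pms L ι₁ V Γ) 4 (U.cup2C (U.pms L ι₁ V Γ) 2 η (conj η)) = kappa hpos Γ * t :=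
  (hpos Γ).choose_spec.2 η hη h0

/-- **The Hodge–Riemann form** `⟪y, x⟫_Γ := κ_Γ⁻¹ · tr(x ∪ conj y)` on the carrier (conjugate-linear in the first
variable, linear in the second — Mathlib's convention). [folklore] -/
def form (Γ : Level V) (y x : Carrier hpos Γ) : ℂ :=
  (kappa hpos Γ)⁻¹ * U.trC (U.pms L ι₁ V Γ) 4 (U.cup2C (U.pms L ι₁ V Γ) 2 (val hpos x) (conj (val hpos y)))

/-- `val` is additive. [folklore] -/
theorem val_add {Γ : Level V} (x y : Carrier hpos Γ) : val hpos (x + y) = val hpos x + val hpos y := rfl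

/-- `val` is `ℂ`-linear. [folklore] -/
theorem val_smul {Γ : Level V} (r : ℂ) (x : Carrier hpos Γ) : val hpos (r • x) = r • val hpos x := rfl

/-- `val` lands in `F²`. [folklore] -/
theorem val_mem {Γ : Level V} (x : Carrier hpos Γ) : val hpos x ∈ F2 U L ι₁ V Γ :=
  ((toCarrier hpos Γ).symm x).2

/-- `val x = 0 ↔ x = 0`. [folklore] -/
theorem val_eq_zero_iff {Γ : Level V} (x : Carrier hpos Γ) : val hpos x = 0 ↔ x = 0 := by
  constructor
  · intro h
    have : (toCarrier hpos Γ).symm x = 0 := Subtype.ext h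
    simpa using this
  · rintro rfl
    simp [val]

/-- Additivity of the form in the first variable. [folklore] -/
theorem form_add_left (Γ : Level V) (x y z : Carrier hpos Γ) :
    form hpos Γ (x + y) z = form hpos Γ x z + form hpos Γ y z := by
  simp only [form, val_add, map_add, (U.cup2C _ 2 _).map_add, mul_add]

/-- Additivity of the form in the second variable. [folklore] -/
theorem form_add_right (Γ : Level V) (x y z : Carrier hpos Γ) :
    form hpos Γ x (y + z) = form hpos Γ x y + form hpos Γ x z := by
  simp only [form, val_add, map_add, LinearMap.add_apply, mul_add]

/-- Conjugate-linearity of the form in the first variable. [folklore] -/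
theorem form_smul_left (Γ : Level V) (r : ℂ) (x y : Carrier hpos Γ) :
    form hpos Γ (r • x) y = starRingEnd ℂ r * form hpos Γ x y := by
  simp only [form, val_smul, HodgeStructure.conj_smul, map_smul, smul_eq_mul]
  ring

/-- Linearity of the form in the second variable. [folklore] -/
theorem form_smul_right (Γ : Level V) (r : ℂ) (x y : Carrier hpos Γ) :
    form hpos Γ x (r • y) = r * form hpos Γ x y := by
  simp only [form, val_smul, map_smul, LinearMap.smul_apply, smul_eq_mul]
  ring

/-- The diagonal of the Hodge–Riemann form is a non-negative real, positive off zero. [folklore] -/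
theorem form_self (Γ : Level V) (x : Carrier hpos Γ) :
    ∃ t : ℝ, 0 ≤ t ∧ form hpos Γ x x = t ∧ (x ≠ 0 → 0 < t) := by
  by_cases hx : x = 0
  · refine ⟨0, le_rfl, ?_, fun h => (h hx).elim⟩
    subst hx
    simp [form, val]
  · have h0 : val hpos x ≠ 0 := fun h => hx ((val_eq_zero_iff hpos x).1 h)
    obtain ⟨t, ht, e⟩ := kappa_spec hpos Γ (val_mem hpos x) h0
    refine ⟨t, ht.le, ?_, fun _ => ht⟩
    rw [form, e, ← mul_assoc, inv_mul_cancel₀ (kappa_ne_zero hpos Γ), one_mul]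

/-- The diagonal of the form is real. [folklore] -/
theorem form_self_real (Γ : Level V) (x : Carrier hpos Γ) : starRingEnd ℂ (form hpos Γ x x) = form hpos Γ x x := by
  obtain ⟨t, -, e, -⟩ := form_self hpos Γ x
  rw [e, Complex.conj_ofReal]

/-- The Hodge–Riemann form is hermitian (polarisation of the real diagonal). [folklore] -/
theorem form_conj_symm (Γ : Level V) (x y : Carrier hpos Γ) : starRingEnd ℂ (form hpos Γ y x) = form hpos Γ x y :=
  conj_symm_of_diag_real (form hpos Γ) (form_add_left hpos Γ) (form_add_right hpos Γ) (form_smul_left hpos Γ)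
    (form_smul_right hpos Γ) (form_self_real hpos Γ) x y

/-- The `InnerProductSpace.Core` of the level-`Γ` summand. [folklore] -/
@[reducible]
def core (Γ : Level V) : InnerProductSpace.Core ℂ (Carrier hpos Γ) where
  inner := form hpos Γ
  conj_inner_symm x y := form_conj_symm hpos Γ x y
  re_inner_nonneg x := by
    obtain ⟨t, ht, e, -⟩ := form_self hpos Γ x
    show 0 ≤ RCLike.re (form hpos Γ x x)
    rw [e]
    simpa using ht
  add_left := form_add_left hpos Γ
  smul_left x y r := form_smul_left hpos Γ r x y
  definite x hx := by
    by_contra h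
    obtain ⟨t, -, e, hpos'⟩ := form_self hpos Γ x
    have : (t : ℂ) = 0 := by rw [← e]; exact hx
    exact (hpos' h).ne' (by exact_mod_cast this)

/-- Normed group structure of the summand (from the core). [folklore] -/
instance instNormedAddCommGroup (Γ : Level V) : NormedAddCommGroup (Carrier hpos Γ) :=
  @InnerProductSpace.Core.toNormedAddCommGroup ℂ (Carrier hpos Γ) _ _ _ (core hpos Γ)

/-- Inner-product space structure of the summand (from the core). [folklore] -/
instance instInnerProductSpace (Γ : Level V) : InnerProductSpace ℂ (Carrier hpos Γ) :=
  InnerProductSpace.ofCore _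

/-- The inner product of the summand is the Hodge–Riemann form. [folklore] -/
theorem inner_def (Γ : Level V) (x y : Carrier hpos Γ) : ⟪x, y⟫_ℂ = form hpos Γ x y := rfl

/-- A linear projection `H²(P_Γ, ℂ) → F²H²(P_Γ, ℂ)` (along a chosen complement), the identity on `F²`. [folklore] -/
def proj (Γ : Level V) : U.CohC (U.pms L ι₁ V Γ) 2 →ₗ[ℂ] ↥(F2 U L ι₁ V Γ) :=
  (F2 U L ι₁ V Γ).projectionOnto (F2 U L ι₁ V Γ).exists_isCompl.choose (F2 U L ι₁ V Γ).exists_isCompl.choose_spec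

omit hpos in
/-- The projection is the identity on `F²`. [folklore] -/
theorem proj_apply_of_mem (Γ : Level V) {x : U.CohC (U.pms L ι₁ V Γ) 2} (hx : x ∈ F2 U L ι₁ V Γ) :
    proj (U := U) Γ x = ⟨x, hx⟩ :=
  Submodule.projectionOnto_apply_of_mem_left _ hx

/-- The level-`Γ` component map `H²(P_Γ, ℂ) → Carrier Γ` (projection, then the identification). [folklore] -/
def comp (Γ : Level V) : U.CohC (U.pms L ι₁ V Γ) 2 →ₗ[ℂ] Carrier hpos Γ :=
  (toCarrier hpos Γ).toLinearMap ∘ₗ proj Γ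

/-- On `F²` the component map is the identity on underlying classes. [folklore] -/
theorem val_comp_of_mem (Γ : Level V) {x : U.CohC (U.pms L ι₁ V Γ) 2} (hx : x ∈ F2 U L ι₁ V Γ) :
    val hpos (comp hpos Γ x) = x := by
  simp [comp, val, proj_apply_of_mem Γ hx]

end HodgeRiemannModel

/-! ## 2. The model -/

open HodgeRiemannModel in
open scoped Classical in
/-- **The level-orthogonal Hodge–Riemann model of the automorphic meeting datum** (item (iii), meeting form), for ANY
universe with `Fact_pull_id` whose Picard modular surfaces of `(L, ι₁, V)` satisfy Hodge–Riemann `(2,0)` with sign: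
`HG := ℓ²(Γ ↦ (F²H²(P_Γ, ℂ), Hodge–Riemann))`, `emb Γ := lp.single Γ ∘ proj_Γ`, `inner_emb` with constant `κ_Γ⁻¹`,
`levelMeet` by orthogonality of distinct levels and the identity morphisms.  TAUTOLOGICAL: see the module docstring —
this is a calibration of the typed axiom, not the adelic model of PerL §3.1. [folklore] -/
def AutomorphicMeeting.ofHodgeRiemann (hid : U.Fact_pull_id)
    (hpos : ∀ Γ : Level V, ∃ κ : ℂ, κ ≠ 0 ∧ ∀ η ∈ F2 U L ι₁ V Γ, η ≠ 0 →
      ∃ t : ℝ, 0 < t ∧ U.trC (U.pms L ι₁ V Γ) 4 (U.cup2C (U.pms L ι₁ V Γ) 2 η (conj η)) = κ * t) :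
    AutomorphicMeeting U ι₁ V where
  HG := lp (Carrier hpos) 2
  emb Γ := (lp.lsingle (𝕜 := ℂ) 2 Γ : Carrier hpos Γ →ₗ[ℂ] lp (Carrier hpos) 2) ∘ₗ comp hpos Γ
  inner_emb Γ := by
    refine ⟨(kappa hpos Γ)⁻¹, inv_ne_zero (kappa_ne_zero hpos Γ), fun x y hx hy => ?_⟩
    show ⟪lp.single 2 Γ (comp hpos Γ y), lp.single 2 Γ (comp hpos Γ x)⟫_ℂ = _
    rw [lp.inner_single_left, lp.single_apply_self, inner_def, form, val_comp_of_mem hpos Γ hx,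
      val_comp_of_mem hpos Γ hy]
  levelMeet Γ₁ Γ₂ x y hx hy h := by
    by_cases hΓ : Γ₁ = Γ₂
    · subst hΓ
      refine ⟨Γ₁, U.idMor _, U.idMor _, ?_⟩
      have e : U.pullC (U.idMor (U.pms L ι₁ V Γ₁)) 2 = LinearMap.id := by
        rw [Universe.pullC, hid, LinearMap.baseChange_id]
      rw [e]
      exact h
    · exfalso
      apply h
      show ⟪lp.single 2 Γ₂ (comp hpos Γ₂ y), lp.single 2 Γ₁ (comp hpos Γ₁ x)⟫_ℂ = 0
      rw [lp.inner_single_left, lp.single_apply_ne 2 Γ₁ _ (Ne.symm hΓ), inner_zero_right]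

namespace AutomorphicMeeting

open HodgeRiemannModel

variable (hid : U.Fact_pull_id)
  (hpos : ∀ Γ : Level V, ∃ κ : ℂ, κ ≠ 0 ∧ ∀ η ∈ F2 U L ι₁ V Γ, η ≠ 0 →
    ∃ t : ℝ, 0 < t ∧ U.trC (U.pms L ι₁ V Γ) 4 (U.cup2C (U.pms L ι₁ V Γ) 2 η (conj η)) = κ * t)

open scoped Classical in
/-- **Distinct levels are orthogonal** in the Hodge–Riemann model: `⟪emb Γ₂ y, emb Γ₁ x⟫ = 0` for `Γ₁ ≠ Γ₂` and ALL
classes `x, y` — the reason `levelMeet` is vacuous across levels, and the reason this model says nothing about how the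
theta forms of different levels meet. [folklore] -/
theorem ofHodgeRiemann_inner_emb_eq_zero_of_ne {Γ₁ Γ₂ : Level V} (hne : Γ₁ ≠ Γ₂)
    (x : U.CohC (U.pms L ι₁ V Γ₁) 2) (y : U.CohC (U.pms L ι₁ V Γ₂) 2) :
    ⟪(ofHodgeRiemann hid hpos).emb Γ₂ y, (ofHodgeRiemann hid hpos).emb Γ₁ x⟫_ℂ = 0 := by
  show ⟪lp.single 2 Γ₂ (comp hpos Γ₂ y), lp.single 2 Γ₁ (comp hpos Γ₁ x)⟫_ℂ = 0
  rw [lp.inner_single_left, lp.single_apply_ne 2 Γ₁ _ (Ne.symm hne), inner_zero_right]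

open scoped Classical in
/-- **At one level the pairing IS the Hodge–Riemann pairing**: for `x, y ∈ F²H²(P_Γ)`,
`⟪emb Γ y, emb Γ x⟫ = κ_Γ⁻¹ · tr(x ∪ conj y)`.  With `x = ω₁ ∪ ω₂`, `y = ω₃ ∪ ω₄` this is `κ_Γ⁻¹` times the quadrilinear
period `∫ ω₁ ∧ ω₂ ∧ \overline{ω₃ ∧ ω₄}` (`Universe.period_eq_pairing_wedges`): in this model the MEETING-coupling of the
engine `periodNV_of_meeting` is the period non-vanishing itself — the calibration. [folklore] -/
theorem ofHodgeRiemann_inner_emb_apply (Γ : Level V) {x y : U.CohC (U.pms L ι₁ V Γ) 2}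
    (hx : x ∈ (U.hodge (U.pms L ι₁ V Γ) 2).F 2) (hy : y ∈ (U.hodge (U.pms L ι₁ V Γ) 2).F 2) :
    ⟪(ofHodgeRiemann hid hpos).emb Γ y, (ofHodgeRiemann hid hpos).emb Γ x⟫_ℂ =
      (kappa hpos Γ)⁻¹ * U.trC (U.pms L ι₁ V Γ) 4 (U.cup2C (U.pms L ι₁ V Γ) 2 x (conj y)) := by
  show ⟪lp.single 2 Γ (comp hpos Γ y), lp.single 2 Γ (comp hpos Γ x)⟫_ℂ = _
  rw [lp.inner_single_left, lp.single_apply_self, inner_def, form, val_comp_of_mem hpos Γ hx,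
    val_comp_of_mem hpos Γ hy]

/-- **Same-level periods from a non-zero pairing**: if `⟪emb Γ' (ω₃ ∪ ω₄), emb Γ (ω₁ ∪ ω₂)⟫ ≠ 0` in the Hodge–Riemann
model (the shape of a `couplingMeet` witness) then `Γ' = Γ` — distinct levels never meet here. [folklore] -/
theorem ofHodgeRiemann_eq_of_inner_emb_ne_zero {Γ Γ' : Level V} (x : U.CohC (U.pms L ι₁ V Γ) 2)
    (y : U.CohC (U.pms L ι₁ V Γ') 2)
    (h : ⟪(ofHodgeRiemann hid hpos).emb Γ' y, (ofHodgeRiemann hid hpos).emb Γ x⟫_ℂ ≠ 0) : Γ' = Γ := by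
  by_contra hne
  exact h (ofHodgeRiemann_inner_emb_eq_zero_of_ne hid hpos (Ne.symm hne) x y)

/-- **The period at one level from a same-level pairing** in the Hodge–Riemann model: for one-forms `ω` with both wedges in
`F²H²(P_Γ)`, `⟪emb Γ (ω₂ ∪ ω₃), emb Γ (ω₀ ∪ ω₁)⟫ ≠ 0 ↔ ∫ ω₀ ∧ ω₁ ∧ \overline{ω₂ ∧ ω₃} ≠ 0` — the engine's input and
output coincide. [folklore] -/
theorem ofHodgeRiemann_inner_emb_wedges_ne_zero_iff (Γ : Level V) (ω : Fin 4 → U.CohC (U.pms L ι₁ V Γ) 1)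
    (h01 : U.cup2C (U.pms L ι₁ V Γ) 1 (ω 0) (ω 1) ∈ (U.hodge (U.pms L ι₁ V Γ) 2).F 2)
    (h23 : U.cup2C (U.pms L ι₁ V Γ) 1 (ω 2) (ω 3) ∈ (U.hodge (U.pms L ι₁ V Γ) 2).F 2) :
    ⟪(ofHodgeRiemann hid hpos).emb Γ (U.cup2C (U.pms L ι₁ V Γ) 1 (ω 2) (ω 3)),
        (ofHodgeRiemann hid hpos).emb Γ (U.cup2C (U.pms L ι₁ V Γ) 1 (ω 0) (ω 1))⟫_ℂ ≠ 0 ↔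
      U.period (U.pms L ι₁ V Γ) ω ≠ 0 := by
  rw [ofHodgeRiemann_inner_emb_apply hid hpos Γ h01 h23, Universe.period_eq_pairing_wedges,
    mul_ne_zero_iff, and_iff_right (inv_ne_zero (kappa_ne_zero hpos Γ))]

end AutomorphicMeeting

/-! ## 3. The typed axiom of item (iii), meeting form, is inhabited from Hodge–Riemann alone -/

/-- **`AutomorphicMeetingExists U` from Hodge–Riemann `(2,0)` with sign + `Fact_pull_id`** (every CM field `L` — the degree
hypothesis `4 ≤ [L:ℚ]` is idle —, every `ι₁`, every `V`).  Calibration: the meeting-form typed axiom of item (iii) carries no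
arithmetic content in isolation. [folklore] -/
theorem automorphicMeetingExists_of_hodgeRiemann (hid : U.Fact_pull_id)
    (hpos : ∀ (L : CMField) (ι₁ : L →+* ℂ) (V : HermSpace3 L ι₁) (Γ : Level V), ∃ κ : ℂ, κ ≠ 0 ∧
      ∀ η ∈ (U.hodge (U.pms L ι₁ V Γ) 2).F 2, η ≠ 0 →
        ∃ t : ℝ, 0 < t ∧ U.trC (U.pms L ι₁ V Γ) 4 (U.cup2C (U.pms L ι₁ V Γ) 2 η (conj η)) = κ * t) :
    AutomorphicMeetingExists U :=
  fun L _ ι₁ V => ⟨AutomorphicMeeting.ofHodgeRiemann hid (hpos L ι₁ V)⟩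

/-- Face scope of the same. [folklore] -/
theorem faceAutomorphicMeetingExists_of_hodgeRiemann (hid : U.Fact_pull_id)
    (hpos : ∀ (L : CMField) (ι₁ : L →+* ℂ) (V : HermSpace3 L ι₁) (Γ : Level V), ∃ κ : ℂ, κ ≠ 0 ∧
      ∀ η ∈ (U.hodge (U.pms L ι₁ V Γ) 2).F 2, η ≠ 0 →
        ∃ t : ℝ, 0 < t ∧ U.trC (U.pms L ι₁ V Γ) 4 (U.cup2C (U.pms L ι₁ V Γ) 2 η (conj η)) = κ * t) :
    FaceAutomorphicMeetingExists U :=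
  faceAutomorphicMeetingExists_of_general (automorphicMeetingExists_of_hodgeRiemann hid hpos)

end Transposition

/-! ## 4. The universe of record -/

namespace Model

open Literature.NumberTheory.Automorphic
open Literature.NumberTheory.Automorphic.PicardCM
open Literature.AlgebraicGeometry.HodgeTheory
open Literature.AlgebraicGeometry.Motives.HodgeStructure (conj)

/-- **Hodge–Riemann `(2,0)` WITH SIGN on every Picard modular surface of the model universe** (a THEOREM of the tree:
`BettiUniverse.hodgeRiemann_two_zero_positive`, Voisin I Thm. 6.32; the realised surface has `dim = 2` by construction):
one constant `κ_Γ ≠ 0` per surface with `tr(η ∪ conj η) = κ_Γ · t`, `t > 0`, for every non-zero `η ∈ F²H²(P_Γ)`. [folklore] -/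
theorem universeOf_hodgeRiemann_pms_positive (hHD : exists_isReal_hodgeModel) (hI : hodgePQ_independent_of_hodgeModel)
    (hU : BallQuotientUniformisedDatum) (h₃ : CMAbelianVarietyRealised) {L : CMField} {ι₁ : L →+* ℂ}
    (V : HermSpace3 L ι₁) (Γ : Level V) :
    ∃ κ : ℂ, κ ≠ 0 ∧ ∀ η ∈ ((universeOf hHD hI hU h₃).hodge ((universeOf hHD hI hU h₃).pms L ι₁ V Γ) 2).F 2, η ≠ 0 →
      ∃ t : ℝ, 0 < t ∧ (universeOf hHD hI hU h₃).trC ((universeOf hHD hI hU h₃).pms L ι₁ V Γ) 4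
        ((universeOf hHD hI hU h₃).cup2C ((universeOf hHD hI hU h₃).pms L ι₁ V Γ) 2 η (conj η)) = κ * t :=
  BettiUniverse.hodgeRiemann_two_zero_positive hHD (Var.isSmoothProjective hU h₃ (.pms (pmsCode L ι₁ V Γ))) rfl

/-- **Item (iii), meeting form, on the model universe: inhabited** (general scope: every `L`, `ι₁`, `V`), by the
level-orthogonal Hodge–Riemann model.  CALIBRATION — not the adelic model of PerL §3.1, not progress on B01. [folklore] -/
theorem universeOf_automorphicMeetingExists (hHD : exists_isReal_hodgeModel) (hI : hodgePQ_independent_of_hodgeModel)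
    (hU : BallQuotientUniformisedDatum) (h₃ : CMAbelianVarietyRealised) :
    Transposition.AutomorphicMeetingExists (universeOf hHD hI hU h₃) :=
  Transposition.automorphicMeetingExists_of_hodgeRiemann (universeOf_fact_pull_id hHD hI hU h₃)
    (fun _ _ V Γ => universeOf_hodgeRiemann_pms_positive hHD hI hU h₃ V Γ)

/-- **`AutomorphicMeetingExists U_rec`** on the universe of record (0 binders).  CALIBRATION of item (iii), meeting form:
HC_CM is NOT proved and this is not progress on `FaceThetaDataExists U_rec`. [folklore] -/
theorem automorphicMeetingExists_rec :
    Transposition.AutomorphicMeetingExists (picardCMUniverse exists_isReal_hodgeModel_holds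
      hodgePQ_independent_of_hodgeModel_holds BallQuotient.ballQuotientUniformised_holds cmAbelianVarietyRealised_holds) :=
  universeOf_automorphicMeetingExists _ _ _ _

/-- **`FaceAutomorphicMeetingExists U_rec`** (0 binders) — the face scope consumed by the transposition assembly.
CALIBRATION only. [folklore] -/
theorem faceAutomorphicMeetingExists_rec :
    Transposition.FaceAutomorphicMeetingExists (picardCMUniverse exists_isReal_hodgeModel_holds
      hodgePQ_independent_of_hodgeModel_holds BallQuotient.ballQuotientUniformised_holds cmAbelianVarietyRealised_holds) :=
  Transposition.faceAutomorphicMeetingExists_of_general automorphicMeetingExists_rec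

end Model
end Summit.HodgeConjecture.CorCM
end
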